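import Mathlib
import HarnessLib
import HarnessLib.Audit
import Summits.Parity.Statement
import Literature.NumberTheory.Sieve.LevelOfDistribution

/-!
Route: AsymptoticSieve

CLOSED (retired) 2026-08-15T14:55:31Z by operator:999:1754322 — reason: not-a-thesis: assembly does not conclude the sub-problem Statement — note: D-0027 §2.1 audit (human 2026-08-15: routes that do not decide the summit are removed): the assembly concludes `Literature.NumberTheory.Sieve.BatemanHornAsymptotic ![(Polynomial.X : Polynomial ℤ), Polynomial.X + 2]`, not the sub-problem statement; a NEW conforming route may be opened from the same i. The file is kept as the record of this route; refuted decls are indexed as negative knowledge (`ledger negatives`).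

X1 (AsymptoticSieve). It suffices to show: (a) for every non-degenerate affine system Psi =
(psi_1..psi_t) on Z^d, size <= L, convex K in [-N,N]^d (uniformly as in
Literature.NumberTheory.Sieve.GeneralizedHardyLittlewood), the affine target sequence a_n := sum_{v
in K cap Z^d, psi_t(v) = n} prod_{i<t} Lambda(psi_i(v)) (mass A(x) given by the (t-1)-form
asymptotic, multiplicative density g of sieve dimension 1) satisfies the hypotheses of the
Friedlander-Iwaniec asymptotic sieve for primes [FriedlanderIwaniecASP1998, (1.6)-(1.9), (R) with
x^{2/3} < D(x) < x (R1), and the bilinear Moebius bound (B) in the range (B1) with log delta(x) =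
o(log Delta(x))]; FI Theorem 1 then gives sum_p a_p log p = H A(x)(1+o(1)), i.e. the t-form
asymptotic, and induction on t gives GeneralizedHardyLittlewood; and (b) BatemanHorn (carried as a
conjunct: one-variable polynomial value sequences are thin, A(Y) = Y^{1/g} <= Y^{1/2} < Y^{2/3},
outside FI's (R1); attacked by routes QuadraticRoots / MobiusShiftedPrimes).
Lean one-liner (general form): NOT YET STATABLE -- needs Literature.affineTargetSeq (SieveSequence
of an affine system) and Literature.FIHypotheses (definition requests filed). Twin-prime instance
(d=1,t=2), elaborates now:
(∃ θ : ℝ, 2 / 3 < θ ∧ Literature.NumberTheory.Sieve.HasLevelOfDistribution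
(Literature.NumberTheory.Sieve.SieveSequence.shiftedPrimes 2) θ) ∧ (∀ ε A : ℝ, 0 < ε → 0 < A → ∃ x₀
: ℝ, ∀ x : ℝ, x₀ ≤ x → ∀ N : ℕ, x ^ (1 / 3 + ε) ≤ (N : ℝ) → (N : ℝ) ≤ x ^ (1 / 2 - ε) → ∑ m ∈
Finset.Icc 1 ⌊x⌋₊, |∑ n ∈ (Finset.Ioc N (2 * N)).filter (fun n : ℕ => ((m * n : ℕ) : ℝ) ≤ x),
(ArithmeticFunction.moebius (m * n) : ℝ) * ArithmeticFunction.vonMangoldt (m * n + 2)| ≤ x /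
Real.log x ^ A)

Rationale: WHY THIS LINE. Friedlander-Iwaniec's Theorem 1 [FriedlanderIwaniecASP1998] is the one general
machine known to
produce prime ASYMPTOTICS from sieve axioms; it isolates parity-breaking in a single axiom (B):
bilinear sums
sum_m |sum_{N<n<=2N, mn<=x} gamma(n) mu(mn) a_{mn}| <= A(x)(log x)^{-2} for sqrt(D)/Delta < N <
sqrt(x)/delta,
on top of Type-I level D > x^{2/3} ((R),(R1)). FI, p.1046: the sieve "is quite capable of settling
the twin prime
problem; the stumbling block is (B); even proving (R) to such a high level is currently beyond
reach". Realised for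
a^2+b^4 [FriedlanderIwaniecAnnals1998] and (variant) x^3+2y^3 [HeathBrownActa2001]. Area imported:
sieve theory
proper + dispersion/Kloosterman technology for (R) [BombieriFriedlanderIwaniecActa1986] (PROBLEMS.md
s3 Parity,
bullet 1 "Type I/II inputs beyond the parity barrier + level of distribution"). Literature evidence
that Type-I data
alone at ANY level < 1 cannot decide prime mass:
Literature.NumberTheory.Sieve.bombieri_asymptotic_sieve_indeterminacy,
Literature.NumberTheory.Sieve.parity_barrier_typeI.
RANKED CRUXES.
 r2 (hardest, most informative): (B) with C=1 for the twin sequence a_n = Lambda(n+2):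
    for N in [x^{1/3+eps}, x^{1/2-eps}]: sum_{m<=x} |sum_{N<n<=2N, mn<=x} mu(mn) Lambda(mn+2)| <=
x/(log x)^A.
 r3: (R) at level theta > 2/3 in absolute values: EXISTS theta > 2/3, HasLevelOfDistribution
(shiftedPrimes 2) theta
    (open: BV gives 1/2 = Literature.NumberTheory.Sieve.shiftedPrimes_hasLevelOfDistribution;
nothing beyond 1/2 with absolute values).
 r4: well-factorable substitute: EXISTS theta > 2/3, PrimesHaveWellFactorableLevel theta (BFI 4/7 =
    Literature.NumberTheory.Sieve.bfi_wellFactorable_level; Maynard 3/5); usable only with an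
FI-variant accepting well-factorable
    remainders (flagged, not decomposed).
 r5 (grounding): FI Theorem 1 as a Literature named fact over
Literature.NumberTheory.Sieve.SieveSequence (definition + cite requests).
KILL CRITERIA. Route closes if r2 is refuted (a lower bound >> x/(log x)^A for the bilinear sum,
e.g. from a
parity identity), or if both r3 and r4 are refuted (level > 2/3 inconsistent for Lambda(n+2));
refutation of r3
alone pivots the route onto r4 + FI-variant. If the induction-on-t assembly is refuted (Type-I for
tuple-weighted
sequences not reducible to the (t-1)-case), pivot to d=1 k-tuples only.
NOT DECOMPOSED YET. Heath-Brown-identity/dispersion attack on r2; the induction over t and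
uniformity in (Psi,K,L);
the SieveSequence packaging of affine/polynomial targets (definition requests only); gamma(n,C) for
C>1 in (B2)-(B3).

History (route lifecycle, newest last):
- 2026-08-15T13:49:14Z · CLOSED retired — not-a-thesis: assembly does not conclude the sub-problem Statement (operator:999:1257524)
- 2026-08-15T14:55:31Z · CLOSED retired — not-a-thesis: assembly does not conclude the sub-problem Statement (operator:999:1754322)

sub-problem: BatemanHorn · status: closed(retired) · opened planner-Parity-Survey-0 2026-08-13T13:19:03Z · rev 0 · ledger route-Parity-AsymptoticSieve
GENERATED by the gate from the ledger (D-0016/17). Provers cite these decls: `theorem foo : Summit.Parity.BatemanHorn.Theses.AsymptoticSieve.<Decl> := …` in Summits/Parity/BatemanHorn/Theorems/<Name>.lean.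
-/

namespace Summit.Parity.BatemanHorn.Theses.AsymptoticSieve

open scoped BigOperators Topology Manifold Classical MeasureTheory ProbabilityTheory Matrix InnerProductSpace ComplexConjugate ContinuousMap
open Filter Set Function TopologicalSpace MeasureTheory

attribute [summit_statement] _root_.BatemanHorn

/-- item stmt-Parity-0598 · crux · rank 0 · closed · moot by None · by planner
X1: (a) every affine target sequence a_n = sum_{v in K, psi_t(v)=n} prod_{i<t} Lambda(psi_i(v)) of a
non-degenerate affine system satisfies the Friedlander-Iwaniec ASP hypotheses
[FriedlanderIwaniecASP1998 (1.6)-(1.9),(R),(R1) D>x^{2/3},(B),(B1)-(B3)] uniformly in (Psi,K) with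
||Psi||_N<=L, and (b) BatemanHorn. Signature = twin-prime instance (d=1,t=2: (R) at some theta>2/3
and (B) with C=1) of (a); general form awaits definitions affineTargetSeq/FIHypotheses. -/
@[route_item "route-Parity-AsymptoticSieve"]
def AsieveThesis : Prop :=
  (∃ θ : ℝ, 2 / 3 < θ ∧ ∀ A : ℝ, 0 < A → ∀ᶠ x : ℝ in Filter.atTop, ∀ t : ℝ, t ≤ x → ∑ d ∈ (Finset.Icc 1 ⌊x ^ θ⌋₊).filter (fun d : ℕ => ∀ p ∈ d.primeFactors, d.factorization p ≤ 2), |(∑ n ∈ (Finset.Ioc 0 ⌊t⌋₊).filter (fun n : ℕ => d ∣ n), ArithmeticFunction.vonMangoldt (n + 2)) - Literature.NumberTheory.Sieve.shiftedPrimesDensity 2 d * ∑ n ∈ Finset.Ioc 0 ⌊t⌋₊, ArithmeticFunction.vonMangoldt (n + 2)| ≤ x / Real.log x ^ A) ∧ (∀ ε A : ℝ, 0 < ε → 0 < A → ∃ α : ℝ, 0 < α ∧ ∃ P : ℝ → ℝ, (∀ᶠ x : ℝ in Filter.atTop, 2 ≤ P x ∧ P x ≤ Real.exp (Real.sqrt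 (Real.log x))) ∧ ∀ᶠ x : ℝ in Filter.atTop, ∀ C : ℝ, 1 ≤ C → C ≤ x ^ (1 / 3 : ℝ) → ∀ N : ℝ, x ^ (1 / 3 + ε) ≤ N → N ≤ Real.sqrt x / Real.log x ^ α → ∑ m ∈ Finset.Icc 1 ⌊x⌋₊, |∑ n ∈ (Finset.Ioc ⌊N⌋₊ ⌊2 * N⌋₊).filter (fun n : ℕ => ((m * n : ℕ) : ℝ) ≤ x ∧ n.Coprime m ∧ ∀ p ∈ n.primeFactors, P x ≤ (p : ℝ)), (ArithmeticFunction.moebius n : ℝ) * ((∑ d ∈ (Nat.divisors n).filter (fun d : ℕ => (d : ℝ) ≤ C), ArithmeticFunction.moebius d : ℤ) : ℝ) * ArithmeticFunction.vonMangoldt (m * n + 2)| ≤ x / Real.log x ^ A)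

/-- item stmt-Parity-8578 · crux · rank 0 · closed · moot by None · by planner
[target] Bateman–Horn for the pair (X, X+2): the ordered Euler product converges to C = 𝔖({0,2}) =
2C₂ and #{n ≤ x : n and n+2 prime} ~ C·x/(log x)²; the k = 2 linear slice of the conjunct
BatemanHorn (the conclusion of the Assembly). Why it might fail: It is the twin prime conjecture
with its Hardy–Littlewood asymptotic: open, parity-blocked for every sieve-theoretic input
(PrimePairParity); here it inherits both cruxes. Sources: BatemanHorn1962, HardyLittlewoodPN3,
Literature.Barriers.Parity.PrimePairParity, FriedlanderIwaniecASP1998. -/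
@[route_item "route-Parity-AsymptoticSieve"]
def TwinPrimesBH : Prop :=
  Literature.NumberTheory.Sieve.BatemanHornAsymptotic ![(Polynomial.X : Polynomial ℤ), Polynomial.X + 2]

/-- item stmt-Parity-0600 · crux · rank 2 · closed · moot by None · by planner
FI axiom (B) with C=1 for a_n = Lambda(n+2) (twin-prime instance; the parity-breaking input): for
every eps,A>0, x large, and every N in [x^{1/3+eps}, x^{1/2-eps}]: sum_{m<=x} | sum_{N<n<=2N, mn<=x}
mu(mn) Lambda(mn+2) | <= x/(log x)^A. Open; FI p.1046: 'we have no idea how to prove (B)' for this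
sequence. -/
@[route_item "route-Parity-AsymptoticSieve"]
def AsieveBilinearBTwin : Prop :=
  ∀ ε A : ℝ, 0 < ε → 0 < A → ∃ α : ℝ, 0 < α ∧ ∃ P : ℝ → ℝ, (∀ᶠ x : ℝ in Filter.atTop, 2 ≤ P x ∧ P x ≤ Real.exp (Real.sqrt (Real.log x))) ∧ ∀ᶠ x : ℝ in Filter.atTop, ∀ C : ℝ, 1 ≤ C → C ≤ x ^ (1 / 3 : ℝ) → ∀ N : ℝ, x ^ (1 / 3 + ε) ≤ N → N ≤ Real.sqrt x / Real.log x ^ α → ∑ m ∈ Finset.Icc 1 ⌊x⌋₊, |∑ n ∈ (Finset.Ioc ⌊N⌋₊ ⌊2 * N⌋₊).filter (fun n : ℕ => ((m * n : ℕ) : ℝ) ≤ x ∧ n.Coprime m ∧ ∀ p ∈ n.primeFactors, P x ≤ (p : ℝ)), (ArithmeticFunction.moebius n : ℝ) * ((∑ d ∈ (Nat.divisors n).filter (fun d : ℕ => (d : ℝ) ≤ C), ArithmeticFunction.moebius d : ℤ) : ℝ) * ArithmeticFunction.vonMangoldt (m * n + 2)| ≤ x / Real.log x ^ A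

/-- item stmt-Parity-0601 · support · rank 3 · closed · moot by None · by planner
FI axiom (R),(R1) for the twin sequence: the shifted primes Lambda(n+2) have level of distribution
x^theta (absolute values of remainders, all squarefree moduli) for SOME theta > 2/3. Known: every
theta < 1/2 (Bombieri-Vinogradov,
Literature.NumberTheory.Sieve.shiftedPrimes_hasLevelOfDistribution); EH asserts all theta<1. Open. -/
@[route_item "route-Parity-AsymptoticSieve"]
def AsieveLevelTwoThirds : Prop :=
  ∃ θ : ℝ, 2 / 3 < θ ∧ ∀ A : ℝ, 0 < A → ∀ᶠ x : ℝ in Filter.atTop, ∀ t : ℝ, t ≤ x → ∑ d ∈ (Finset.Icc 1 ⌊x ^ θ⌋₊).filter (fun d : ℕ => ∀ p ∈ d.primeFactors, d.factorization p ≤ 2), |(∑ n ∈ (Finset.Ioc 0 ⌊t⌋₊).filter (fun n : ℕ => d ∣ n), ArithmeticFunction.vonMangoldt (n + 2)) - Literature.NumberTheory.Sieve.shiftedPrimesDensity 2 d * ∑ n ∈ Finset.Ioc 0 ⌊t⌋₊, ArithmeticFunction.vonMangoldt (n + 2)| ≤ x / Real.log x ^ A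

/-- item stmt-Parity-0602 · support · rank 4 · closed · moot by None · by planner
Well-factorable substitute for (R): the primes have well-factorable level x^theta for SOME theta >
2/3 (BFI 1986 Thm 10 gives 4/7 = Literature.NumberTheory.Sieve.bfi_wellFactorable_level; Maynard
2020/25 gives 3/5 with triply-well-factorable weights). Usable in the route only together with an
FI-ASP variant accepting well-factorable remainders (not decomposed). -/
@[route_item "route-Parity-AsymptoticSieve"]
def AsieveWellfactorableTwoThirds : Prop :=
  ∃ θ : ℝ, 2 / 3 < θ ∧ Literature.NumberTheory.Sieve.PrimesHaveWellFactorableLevel θ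

-- item stmt-Parity-0603 · support · rank 5 · closed · moot by None · by planner — informal only, no Lean statement yet:
--   Grounding fact (Literature, to be stated as a named Prop over
--   Literature.NumberTheory.Sieve.SieveSequence): Friedlander-Iwaniec, Asymptotic sieve for primes, Ann.
--   Math. 148 (1998), Theorem 1: if (a_n) >= 0 supported on squarefrees satisfies (1.6) A_d << d^{-1}
--   tau(d)^8 A(x) for d <= x^{1/3}, (1.7)-(1.9) (multiplicative g, 0<=g(p)<1, g(p)<<1/p, sum_{p<=y} g(p)
--   = loglog y + c + O((log y)^{-10})), (R) sum_{d<=D} mu^2(d)|r_d(t)| <= A(x)(log x)^{-2} for t<=x with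
--   x^{2/3} < D < x, and (B) sum_m |sum_{N<n<=2N, mn<=x} gamma(n,C) mu(mn) a_{mn}| <= A(x)(log x)^{-2}
--   for all N in (sqrt(D)/Delta, sqrt(x)/d

/-- item stmt-Parity-8636 · support · rank 9 · closed · moot by None · by planner
[support] from the Λ-weighted twin asymptotic Σ_{n≤x} Λ(n)Λ(n+2) ~ 𝔖({0,2})·x (over ℕ, the
conclusion shape shared with route MobiusShiftedPrimes' assembly) to Bateman–Horn for (X, X+2):
partial summation, prime powers O(√x log² x), and the ordered BH constant of (X, X+2) equals
𝔖({0,2}) = 2C₂ factorwise (ω(2) = 1, ω(p) = 2; tendsto_singularSeriesPartial_holds,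
singularSeries_pair_holds, singularSeries_pos_iff_holds). Twin-specific on purpose: the general
LambdaToCount (stmt-Parity-0874) needs Siegel-type finiteness for degree ≥ 3 and is not wanted here.
[difficulty: provable-now] Sources: BatemanHorn1962, HardyLittlewoodPN3,
Literature.NumberTheory.Sieve.tendsto_singularSeriesPartial,
Literature.NumberTheory.Sieve.singularSeries_pair. [difficulty: provable-now] -/
@[route_item "route-Parity-AsymptoticSieve"]
def TwinLambdaToCount : Prop :=
  Asymptotics.IsEquivalent Filter.atTop (fun x : ℕ => ∑ n ∈ Finset.Icc 1 x, ArithmeticFunction.vonMangoldt n * ArithmeticFunction.vonMangoldt (n + 2)) (fun x : ℕ => Literature.NumberTheory.Sieve.singularSeries ({0, 2} : Finset ℤ) * (x : ℝ)) → Literature.NumberTheory.Sieve.BatemanHornAsymptotic ![(Polynomial.X : Polynomial ℤ), Polynomial.X + 2]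

/-- item stmt-Parity-8637 · support · rank 9 · closed · moot by None · by planner
[support] the declared target is a slice of the sub-problem: BatemanHorn → TwinPrimesBH, i.e. (X,
X+2) is a Bateman–Horn system (X, X+2 prime elements of ℤ[X], monic, not associated; ω(2) = 1 < 2,
ω(p) = 2 < p for p ≥ 3). Documents 'implied by, not implying' formally; not used in the Assembly.
[difficulty: provable-now] Sources: BatemanHorn1962,
Literature.NumberTheory.Sieve.BatemanHornConjecture. [difficulty: provable-now] -/
@[route_item "route-Parity-AsymptoticSieve"]
def TwinSliceOfBH : Prop :=
  BatemanHorn → Literature.NumberTheory.Sieve.BatemanHornAsymptotic ![(Polynomial.X : Polynomial ℤ), Polynomial.X + 2]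

/-- item stmt-Parity-0599 · assembly · rank 1 · closed · moot by None · by planner
X1 -> Parity. (i) FI Theorem 1 [FriedlanderIwaniecASP1998 Thm 1] applied to the affine target
sequence of Psi gives sum_n prod_{i<=t} Lambda(psi_i) = beta_infty prod_p beta_p + o(N^d) provided
the (t-1)-form asymptotic supplies A(x) and g (induction on t, base t=1 = PNT / Siegel-Walfisz over
convex bodies); uniformity in (Psi,K,L) from uniform constants in FI; H = prod_p beta_p / (previous
constant) by the Euler-product identity (1.13)-(1.14). (ii) conjunct (b) is BatemanHorn verbatim.
Twin instance to prove first: X1_twin -> (fun x => sum_{n<=x} Lambda(n)Lambda(n+2)) ~ singularSeries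
{0,2} * x. -/
@[route_item "route-Parity-AsymptoticSieve"]
def Assembly : Prop :=
  AsieveLevelTwoThirds → AsieveBilinearBTwin → (Asymptotics.IsEquivalent Filter.atTop (fun x : ℕ => ∑ n ∈ Finset.Icc 1 x, ArithmeticFunction.vonMangoldt n * ArithmeticFunction.vonMangoldt (n + 2)) (fun x : ℕ => Literature.NumberTheory.Sieve.singularSeries ({0, 2} : Finset ℤ) * (x : ℝ)) → Literature.NumberTheory.Sieve.BatemanHornAsymptotic ![(Polynomial.X : Polynomial ℤ), Polynomial.X + 2]) → Literature.NumberTheory.Sieve.BatemanHornAsymptotic ![(Polynomial.X : Polynomial ℤ), Polynomial.X + 2]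

end Summit.Parity.BatemanHorn.Theses.AsymptoticSieve
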